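import Summits.MatrixMultiplication.MatrixMultiplication.Theorems.TetrahedronTensor
import HarnessLib

/-!
# Tetrahedron tensor — Kronecker sub-multiplicativity in the level

`T(K₄)_{N·M} ≅ T(K₄)_N ⊠ T(K₄)_M` (graph tensors multiply edge-wise under the Kronecker product,
Christandl–Vrana–Zuiddam 2019, §1.1, the engine of their Prop. 1.1.16 "exponent = asymptotic
log-rank"): with pair labels `Fin (N·M) ≃ Fin N × Fin M` on every edge, the tetrahedron tensor at
level `N·M` factorises POINTWISE as the product of the level-`N` tensor on first components and the
level-`M` tensor on second components (`tetra_mul_apply`), whence rank-one decompositions multiply and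

  `R₄(T(K₄)_{N·M}) ≤ R₄(T(K₄)_N) · R₄(T(K₄)_M)`   (`tensorRankD_tetra_mul_le`),

and by induction `R₄(T(K₄)_{N^j}) ≤ R₄(T(K₄)_N)^j` (`tensorRankD_tetra_pow_le`). Consequence for the
exponent (`mem_tetraAdmissibleExponents_of_level`, `omegaTetra_le_of_level`): a single finite LEVEL
CERTIFICATE `R₄(T(K₄)_N) ≤ N^θ` (`N ≥ 2`, `0 ≤ θ`) gives `ω(K₄) ≤ θ` (powers of the level +
monotonicity in the level `tensorRankD_tetra_mono` + interpolation), and conversely-shaped: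
`omegaTetra_le_four_of_levels` — certificates with exponents `4 + 1/(k+1)` for every `k` give
`ω(K₄) ≤ 4`, the attacked conjunct `TetraFlat` of the tetrahedron carving (decomp-mm lens 6, g13).
All statements are over an arbitrary field; sorry-free.
-/

noncomputable section

set_option linter.dupNamespace false

namespace Summit.MatrixMultiplication.MatrixMultiplication.Theorems.TetrahedronTensor

open Filter Asymptotics
open Literature.Computability.AlgebraicComplexity

section Kronecker

variable {F : Type*} [Field F]

/-- First (`Fin N`) components of the three labels of a leg index at the product level `N·M`
(labels `Fin (N·M) ≃ Fin N × Fin M` via `finProdFinEquiv`), re-encoded as a level-`N` leg index. -/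
def K₁ {N M : ℕ} (x : Fin ((N * M) ^ 3)) : Fin (N ^ 3) :=
  finFunctionFinEquiv fun j => (finProdFinEquiv.symm (finFunctionFinEquiv.symm x j)).1

/-- Second (`Fin M`) components of the three labels of a leg index at the product level `N·M`,
re-encoded as a level-`M` leg index. -/
def K₂ {N M : ℕ} (x : Fin ((N * M) ^ 3)) : Fin (M ^ 3) :=
  finFunctionFinEquiv fun j => (finProdFinEquiv.symm (finFunctionFinEquiv.symm x j)).2

/-- **Pointwise Kronecker factorisation** `T(K₄)_{N·M}(i) = T(K₄)_N(K₁ ∘ i) · T(K₄)_M(K₂ ∘ i)`: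
a 4-tuple of pair-label triples is consistent iff both component 4-tuples are.
[cite: ChristandlVranaZuiddam2016, §1.1 (graph tensors multiply under ⊠)] -/
theorem tetra_mul_apply {N M : ℕ} (i : Fin 4 → Fin ((N * M) ^ 3)) :
    tetra F (N * M) i = tetra F N (fun v => K₁ (i v)) * tetra F M (fun v => K₂ (i v)) := by
  have e : ∀ x y : Fin (N * M), x = y ↔
      ((finProdFinEquiv.symm x).1 = (finProdFinEquiv.symm y).1 ∧
        (finProdFinEquiv.symm x).2 = (finProdFinEquiv.symm y).2) := fun x y => by
    rw [← Prod.ext_iff, Equiv.apply_eq_iff_eq]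
  simp only [tetra, ite_one_zero_mul_ite, K₁, K₂, Equiv.symm_apply_apply]
  refine if_congr ?_ rfl rfl
  simp only [consistent_iff, e]
  tauto

/-- A rank-one decomposition of `T(K₄)_n` of length exactly `R₄(T(K₄)_n)`. [folklore] -/
theorem exists_rankOne_decomposition_tetra (n : ℕ) :
    ∃ u : Fin (tensorRankD (tetra F n)) → Fin 4 → Fin (n ^ 3) → F,
      ∑ k, rankOneTensor (u k) = tetra F n := by
  classical
  obtain ⟨g, hg, hs⟩ := sComplexity_spec (tetra_decomposable (F := F) n)
  simp only [rankOneTensors, Set.mem_range] at hg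
  choose u hu using hg
  have h : ∑ k, rankOneTensor (u k) = ∑ k, g k := Finset.sum_congr rfl fun k _ => hu k
  exact ⟨u, h.trans hs⟩

/-- **Kronecker sub-multiplicativity** `R₄(T(K₄)_{N·M}) ≤ R₄(T(K₄)_N) · R₄(T(K₄)_M)`: the products
of the legs of two rank-one decompositions (first components through the level-`N` legs, second
components through the level-`M` legs) decompose `T(K₄)_{N·M}`.
[cite: ChristandlVranaZuiddam2016, Prop. 1.1.16 (proof)] -/
theorem tensorRankD_tetra_mul_le (N M : ℕ) :
    tensorRankD (tetra F (N * M)) ≤ tensorRankD (tetra F N) * tensorRankD (tetra F M) := by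
  classical
  obtain ⟨u₁, hu₁⟩ := exists_rankOne_decomposition_tetra (F := F) N
  obtain ⟨u₂, hu₂⟩ := exists_rankOne_decomposition_tetra (F := F) M
  set L : Fin (tensorRankD (tetra F N)) × Fin (tensorRankD (tetra F M)) →
      Fin 4 → Fin ((N * M) ^ 3) → F :=
    fun k v x => u₁ k.1 v (K₁ x) * u₂ k.2 v (K₂ x) with hL
  have hsum : ∑ k, rankOneTensor (L k) = tetra F (N * M) := by
    funext i
    rw [Finset.sum_apply, Fintype.sum_prod_type, tetra_mul_apply,
      ← congrFun hu₁ (fun v => K₁ (i v)), ← congrFun hu₂ (fun v => K₂ (i v)),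
      Finset.sum_apply, Finset.sum_apply, Finset.sum_mul_sum]
    refine Finset.sum_congr rfl fun k₁ _ => Finset.sum_congr rfl fun k₂ _ => ?_
    simp only [rankOneTensor_apply, hL, ← Finset.prod_mul_distrib]
  have hcard : Fintype.card (Fin (tensorRankD (tetra F N)) × Fin (tensorRankD (tetra F M))) =
      tensorRankD (tetra F N) * tensorRankD (tetra F M) := by simp
  rw [← hcard]
  let e := Fintype.equivFin (Fin (tensorRankD (tetra F N)) × Fin (tensorRankD (tetra F M)))
  refine tensorRankD_le_of_eq_sum (fun k => L (e.symm k)) ?_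
  rw [← hsum]
  exact Fintype.sum_equiv e.symm _ _ (fun _ => rfl)

/-- Powers of a level: `R₄(T(K₄)_{N^j}) ≤ R₄(T(K₄)_N)^j`. [cite: ChristandlVranaZuiddam2016, Prop. 1.1.16 (proof)] -/
theorem tensorRankD_tetra_pow_le (N j : ℕ) :
    tensorRankD (tetra F (N ^ j)) ≤ tensorRankD (tetra F N) ^ j := by
  induction j with
  | zero =>
    rw [pow_zero]
    have h : tensorRankD (tetra F (N ^ 0)) ≤ (N ^ 0) ^ 6 := tensorRankD_tetra_le (F := F) (N ^ 0)
    simpa using h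
  | succ j ih =>
    calc tensorRankD (tetra F (N ^ (j + 1)))
        = tensorRankD (tetra F (N ^ j * N)) := by rw [pow_succ N j]
      _ ≤ tensorRankD (tetra F (N ^ j)) * tensorRankD (tetra F N) := tensorRankD_tetra_mul_le _ _
      _ ≤ tensorRankD (tetra F N) ^ j * tensorRankD (tetra F N) := Nat.mul_le_mul_right _ ih
      _ = tensorRankD (tetra F N) ^ (j + 1) := (pow_succ _ j).symm

end Kronecker

/-! ## From one level certificate to the exponent -/

section Level

variable (F : Type*) [Field F]

/-- **Level certificate ⟹ admissible exponent.** If `R₄(T(K₄)_N) ≤ N^θ` at some level `N ≥ 2`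
(`θ ≥ 0`), then `R₄(T(K₄)_n) ≤ N^θ · n^θ` for all `n ≥ 1`, so `θ ∈ tetraAdmissibleExponents`:
bound `n` between consecutive powers `N^{j-1} ≤ n < N^j`, use monotonicity in the level and
`R₄(T(K₄)_{N^j}) ≤ (N^θ)^j = (N^j)^θ ≤ (N·n)^θ`. [cite: ChristandlVranaZuiddam2016, Prop. 1.1.16] -/
theorem mem_tetraAdmissibleExponents_of_level {N : ℕ} {θ : ℝ} (hN : 2 ≤ N) (hθ : 0 ≤ θ)
    (hcert : (tensorRankD (tetra F N) : ℝ) ≤ (N : ℝ) ^ θ) :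
    θ ∈ tetraAdmissibleExponents F := by
  have hNpos : 0 < N := by omega
  have hNposR : (0 : ℝ) < N := by exact_mod_cast hNpos
  have hpow : ∀ j : ℕ, (tensorRankD (tetra F (N ^ j)) : ℝ) ≤ ((N : ℝ) ^ θ) ^ j := fun j =>
    calc (tensorRankD (tetra F (N ^ j)) : ℝ) ≤ ((tensorRankD (tetra F N) : ℕ) : ℝ) ^ j := by
          exact_mod_cast tensorRankD_tetra_pow_le (F := F) N j
      _ ≤ ((N : ℝ) ^ θ) ^ j := pow_le_pow_left₀ (Nat.cast_nonneg _) hcert j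
  refine IsBigO.of_bound ((N : ℝ) ^ θ) ?_
  filter_upwards [eventually_ge_atTop 1] with n hn
  rw [Real.norm_of_nonneg (Nat.cast_nonneg _),
    Real.norm_of_nonneg (Real.rpow_nonneg (Nat.cast_nonneg _) _)]
  set j : ℕ := Nat.log N n + 1 with hj
  have hlt : n < N ^ j := Nat.lt_pow_succ_log_self (by omega) n
  have hle : N ^ j ≤ N * n := by
    rw [hj, pow_succ, mul_comm]
    exact Nat.mul_le_mul_left N (Nat.pow_log_le_self N (by omega))
  have hmono : tensorRankD (tetra F n) ≤ tensorRankD (tetra F (N ^ j)) :=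
    tensorRankD_tetra_mono (F := F) hlt.le
  have hcast : ((N : ℝ) ^ θ) ^ j = ((N ^ j : ℕ) : ℝ) ^ θ := by
    rw [Nat.cast_pow, ← Real.rpow_natCast ((N : ℝ) ^ θ) j, ← Real.rpow_mul hNposR.le, mul_comm θ,
      Real.rpow_mul hNposR.le, Real.rpow_natCast]
  have hNj : ((N ^ j : ℕ) : ℝ) ≤ (N : ℝ) * (n : ℝ) := by exact_mod_cast hle
  calc (tensorRankD (tetra F n) : ℝ)
      ≤ (tensorRankD (tetra F (N ^ j)) : ℝ) := by exact_mod_cast hmono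
    _ ≤ ((N : ℝ) ^ θ) ^ j := hpow j
    _ = ((N ^ j : ℕ) : ℝ) ^ θ := hcast
    _ ≤ ((N : ℝ) * (n : ℝ)) ^ θ := Real.rpow_le_rpow (Nat.cast_nonneg _) hNj hθ
    _ = (N : ℝ) ^ θ * (n : ℝ) ^ θ := Real.mul_rpow hNposR.le (Nat.cast_nonneg _)

/-- **Level certificate ⟹ exponent bound**: `R₄(T(K₄)_N) ≤ N^θ` with `N ≥ 2`, `θ ≥ 0` gives
`ω(K₄) ≤ θ`. [cite: ChristandlVranaZuiddam2016, Prop. 1.1.16] -/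
theorem omegaTetra_le_of_level {N : ℕ} {θ : ℝ} (hN : 2 ≤ N) (hθ : 0 ≤ θ)
    (hcert : (tensorRankD (tetra F N) : ℝ) ≤ (N : ℝ) ^ θ) : omegaTetra F ≤ θ :=
  csInf_le (tetraAdmissibleExponents_bddBelow F)
    (mem_tetraAdmissibleExponents_of_level F hN hθ hcert)

/-- **Finite certificates for the flattening exponent.** If for every `k` some level `N ≥ 2`
carries a rank certificate `R₄(T(K₄)_N) ≤ N^{4 + 1/(k+1)}`, then `ω(K₄) ≤ 4` (the attacked conjunct
`TetraFlat` of the tetrahedron carving, in finite-certificate form). [cite: ChristandlVranaZuiddam2016, Prop. 1.1.16] -/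
theorem omegaTetra_le_four_of_levels
    (hlev : ∀ k : ℕ, ∃ N : ℕ, 2 ≤ N ∧
      (tensorRankD (tetra F N) : ℝ) ≤ (N : ℝ) ^ ((4 : ℝ) + 1 / ((k : ℝ) + 1))) :
    omegaTetra F ≤ 4 := by
  have hk : ∀ k : ℕ, omegaTetra F ≤ (4 : ℝ) + 1 / ((k : ℝ) + 1) := fun k => by
    obtain ⟨N, hN, hcert⟩ := hlev k
    exact omegaTetra_le_of_level F hN (by positivity) hcert
  refine le_of_not_gt fun h => ?_
  obtain ⟨k, hk'⟩ := exists_nat_one_div_lt (sub_pos.2 h)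
  have := hk k
  linarith

end Level

end Summit.MatrixMultiplication.MatrixMultiplication.Theorems.TetrahedronTensor

end
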